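import Summits.ValiantsHypothesis.ValiantsHypothesis.Theorems.KPlusLogSqLawOctaveConditioning
import Summits.ValiantsHypothesis.ValiantsHypothesis.Theorems.KPlusLogSqLawTropicalBSmallFormats

/-!
# K1 `OctaveStability` (stmt-ValiantsHypothesis-19561, line «conditioning») — the additive budget must be at least `m/2` on the certified row `(m, 2, m)`

Negative-lane findings of unit `val-neg-3` (g2), sharpening `OctaveStabilityNoBudget.lean` (g0, p608297: K1 with its additive
budget DELETED is false at format `(2, 2)`).  Here the fragile octave of g0 is stacked into a **block ladder**: for every `k`, the
classical symmetric pencil `S₀ + X·S₁` of size `m = 2(k+1)` with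

* `S₀ = ⊕_{i ≤ k} diag(-2^i, 2^i)`, `S₁ = ⊕_{i ≤ k} diag(1, -1)` (exponents `d = (0, 1)`, entry scales `ρ = (2^k, 1)`),

has `pencilDet d S = ∏_{i ≤ k} -(X - 2^i)²`: the double roots `2^0, …, 2^k` occupy `k + 1` distinct dyadic octaves
(`Ω = k + 1 = m/2`), and the SYMMETRIC perturbation `S₀' = ⊕ [[-2^i, ε], [ε, 2^i]]` (entrywise distance `|ε|`, any `ε ≠ 0`)
gives `pencilDet d S' = ∏ -((X - 2^i)² + ε²)`, a nonzero polynomial with NO real root (`Ω = 0`).  The format `(2(k+1), 2)` lies in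
the tree-certified TropRow `TropRootLawAt m 2 m` (`tropRootLawAt_poly m 2`, the polynomial row `n = m`).

Consequences (theorems below, all formats / precisions / constants quantified):
* `octaveStability_false_of_budget_lt` — NO law of K1's shape
  «`TropRootLawAt m K n` ⇒ for symmetric `S, S'`, injective `d`, entry scales `ρ` certified on `S`,
  `2^{P(m,K,n)}·|S' − S| ≤ ρ` entrywise, `pencilDet d S' ≠ 0`: `Ω(pencilDet d S) ≤ b(m,K,n) + A·Ω(pencilDet d S')`»
  holds if `b(2(k+1), 2, 2(k+1)) < k + 1` for some `k` — whatever the precision exponent `P` and the multiplicative constant `A`.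
* `budget_ge_half_of_octaveStabilityShape` — equivalently, every valid law of that shape pays `b(m, 2, m) ≥ m/2` on every even `m`:
  on the polynomial row the additive budget is at least HALF THE ROW'S TROPICAL COUNT `n = m`, while Descartes already gives the
  absolute bound `Ω ≤ m` there; so on certified polynomial rows the conditioning shape is worth at most a constant factor.
* `octaveStability_false_with_bounded_budget` (`b ≡ B`), `octaveStability_false_with_letter_budget` (`b = f(K)`, any `f`):
  no `m`- and `n`-independent additive budget exists, at any precision — the exact statement a sharpened K1 must dodge.
* `octaveStability_budget_at_blockLadder` — K1's own budget on that row is `2^{C(2+⌊log₂m⌋²)}(m+1) ≥ m/2`: `OctaveStability`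
  itself is NOT refuted (an unconditional `¬ OctaveStability` is an octave Conjecture-B monster on a THIN row, not exhibited here);
  `OctaveWeakLifting`, `WeakLifting`, `TropicalB` stay OPEN and untouched.  No summit statement is proved or refuted; VP ≠ VNP is not moved.

Mathlib + the two tree modules above; theorems only (witness matrices written out via `Matrix.blockDiagonal` and the reindexing
`finProdFinEquiv : Fin 2 × Fin (k+1) ≃ Fin (2(k+1))`; no `def`, no notation); no facts. [folklore; explicit witness]
-/

set_option linter.dupNamespace false -- single-conjunct summit: the namespace `ValiantsHypothesis.ValiantsHypothesis` repeats a component (D-0017)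
set_option autoImplicit false

namespace Summit.ValiantsHypothesis.ValiantsHypothesis.Theorems.WeakLifting.Negative

open Polynomial Finset Matrix
open scoped BigOperators
open Summit.ValiantsHypothesis.ValiantsHypothesis.Theorems.LacunarySymmetroidMatrixDescartes.TropicalCensus (TropRootLawAt tropRootLawAt_poly)
open Summit.ValiantsHypothesis.ValiantsHypothesis.Theorems.KPlusLogSqLaw.Octave (octave octaveCount pencilDet OctaveStability)

/-! ## The ladder polynomial `∏ i, -((X - a i)² + ε²)` -/

/-- point values of one rung: `-((x - a)² + ε²)`. [folklore] -/
theorem rung_eval (a ε x : ℝ) : (-((X - C a) ^ 2 + C (ε ^ 2)) : ℝ[X]).eval x = -((x - a) ^ 2 + ε ^ 2) := by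
  simp

/-- point values of the ladder. [folklore] -/
theorem ladder_eval {n : ℕ} (a : Fin n → ℝ) (ε x : ℝ) :
    (∏ i, (-((X - C (a i)) ^ 2 + C (ε ^ 2)) : ℝ[X])).eval x = ∏ i, -((x - a i) ^ 2 + ε ^ 2) := by
  rw [eval_prod]
  exact Finset.prod_congr rfl fun i _ => rung_eval (a i) ε x

/-- the ladder is a nonzero polynomial (every rung is: evaluate at `a i + 1`). [folklore] -/
theorem ladder_ne_zero {n : ℕ} (a : Fin n → ℝ) (ε : ℝ) :
    (∏ i, (-((X - C (a i)) ^ 2 + C (ε ^ 2)) : ℝ[X])) ≠ 0 := by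
  refine Finset.prod_ne_zero_iff.2 fun i _ h => ?_
  have h2 := rung_eval (a i) ε (a i + 1)
  rw [h, eval_zero] at h2
  nlinarith [sq_nonneg ε]

/-- `ε ≠ 0`: the ladder has no real roots at all. [folklore] -/
theorem ladder_roots_eq_zero {n : ℕ} (a : Fin n → ℝ) {ε : ℝ} (hε : ε ≠ 0) :
    (∏ i, (-((X - C (a i)) ^ 2 + C (ε ^ 2)) : ℝ[X])).roots = 0 := by
  refine Multiset.eq_zero_of_forall_notMem fun x hx => ?_
  rw [mem_roots (ladder_ne_zero a ε), IsRoot.def, ladder_eval] at hx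
  have hfac : ∀ i, -((x - a i) ^ 2 + ε ^ 2) ≠ 0 := fun i => by
    have : 0 < (x - a i) ^ 2 + ε ^ 2 := by positivity
    exact neg_ne_zero.2 this.ne'
  exact Finset.prod_ne_zero_iff.2 (fun i _ => hfac i) hx

/-- `ε ≠ 0`: `Ω(ladder) = 0`. [folklore] -/
theorem ladder_octaveCount_ne {n : ℕ} (a : Fin n → ℝ) {ε : ℝ} (hε : ε ≠ 0) :
    octaveCount (∏ i, (-((X - C (a i)) ^ 2 + C (ε ^ 2)) : ℝ[X])) = 0 := by
  unfold octaveCount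
  rw [ladder_roots_eq_zero a hε]
  simp

/-- `ε = 0`, nonzero rungs: the nonzero real roots of the ladder are exactly the `a i`. [folklore] -/
theorem ladder_rootSet {n : ℕ} (a : Fin n → ℝ) (ha : ∀ i, a i ≠ 0) :
    ((∏ i, (-((X - C (a i)) ^ 2 + C ((0 : ℝ) ^ 2)) : ℝ[X])).roots.toFinset.filter (fun x => x ≠ 0)) =
      univ.image a := by
  ext x
  simp only [Finset.mem_filter, Multiset.mem_toFinset, mem_roots', ne_eq, IsRoot.def, ladder_eval, Finset.mem_image,
    Finset.mem_univ, true_and]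
  constructor
  · rintro ⟨⟨-, h0⟩, -⟩
    obtain ⟨i, -, hi⟩ := Finset.prod_eq_zero_iff.1 h0
    refine ⟨i, ?_⟩
    have h2 : (x - a i) ^ 2 = 0 := by nlinarith [sq_nonneg (x - a i)]
    have h3 : x - a i = 0 := pow_eq_zero_iff (n := 2) (by norm_num) |>.1 h2
    linarith
  · rintro ⟨i, rfl⟩
    exact ⟨⟨ladder_ne_zero a 0, Finset.prod_eq_zero (Finset.mem_univ i) (by ring)⟩, ha i⟩

/-- the dyadic ladder `a i = 2^i`, `ε = 0`: `Ω = n` — the double roots `2^0, …, 2^{n-1}` sit in `n` distinct octaves. [folklore] -/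
theorem ladder_octaveCount_zero (n : ℕ) :
    octaveCount (∏ i : Fin n, (-((X - C ((2 : ℝ) ^ (i : ℕ))) ^ 2 + C ((0 : ℝ) ^ 2)) : ℝ[X])) = n := by
  unfold octaveCount
  rw [ladder_rootSet (fun i : Fin n => (2 : ℝ) ^ (i : ℕ)) (fun i => by positivity), Finset.image_image]
  have h : (octave ∘ fun i : Fin n => (2 : ℝ) ^ (i : ℕ)) = fun i : Fin n => ((i : ℕ) : ℤ) := by
    funext i
    show Int.log 2 |(2 : ℝ) ^ (i : ℕ)| = ((i : ℕ) : ℤ)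
    rw [abs_of_pos (by positivity), show (2 : ℝ) ^ (i : ℕ) = ((2 ^ (i : ℕ) : ℕ) : ℝ) by push_cast; rfl,
      Int.log_natCast, Nat.log_pow (by norm_num)]
  rw [h, Finset.card_image_of_injective _ fun i j hij => Fin.ext (by exact_mod_cast hij), Finset.card_univ,
    Fintype.card_fin]

/-! ## Block letters: `2 × 2` blocks on the diagonal, reindexed to `Fin (2n)` by `finProdFinEquiv` -/

/-- entries of a block letter: a block entry on the block diagonal, `0` off it. [folklore] -/
theorem blockLetter_apply {n : ℕ} (B : Fin n → Matrix (Fin 2) (Fin 2) ℝ) (p q : Fin (2 * n)) :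
    Matrix.reindex finProdFinEquiv finProdFinEquiv (Matrix.blockDiagonal B) p q =
      if (finProdFinEquiv.symm p).2 = (finProdFinEquiv.symm q).2 then
        B (finProdFinEquiv.symm p).2 (finProdFinEquiv.symm p).1 (finProdFinEquiv.symm q).1 else 0 :=
  rfl

/-- the diagonal-block entries of a block letter. [folklore] -/
theorem blockLetter_apply_block {n : ℕ} (B : Fin n → Matrix (Fin 2) (Fin 2) ℝ) (k : Fin n) (i j : Fin 2) :
    Matrix.reindex finProdFinEquiv finProdFinEquiv (Matrix.blockDiagonal B) (finProdFinEquiv (i, k))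
      (finProdFinEquiv (j, k)) = B k i j := by
  simp

/-- uniform entry bound for a block letter. [folklore] -/
theorem abs_blockLetter_le {n : ℕ} (B : Fin n → Matrix (Fin 2) (Fin 2) ℝ) {c : ℝ} (hc : 0 ≤ c)
    (hB : ∀ k i j, |B k i j| ≤ c) (p q : Fin (2 * n)) :
    |Matrix.reindex finProdFinEquiv finProdFinEquiv (Matrix.blockDiagonal B) p q| ≤ c := by
  rw [blockLetter_apply]
  split_ifs
  · exact hB _ _ _
  · simpa using hc

/-- block letters subtract blockwise. [folklore] -/
theorem blockLetter_sub {n : ℕ} (B B' : Fin n → Matrix (Fin 2) (Fin 2) ℝ) (p q : Fin (2 * n)) :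
    Matrix.reindex finProdFinEquiv finProdFinEquiv (Matrix.blockDiagonal B') p q -
        Matrix.reindex finProdFinEquiv finProdFinEquiv (Matrix.blockDiagonal B) p q =
      Matrix.reindex finProdFinEquiv finProdFinEquiv (Matrix.blockDiagonal fun k => B' k - B k) p q := by
  rw [blockLetter_apply, blockLetter_apply, blockLetter_apply]
  split_ifs <;> simp [Matrix.sub_apply]

/-- a block letter with symmetric blocks is symmetric. [folklore] -/
theorem blockLetter_isSymm {n : ℕ} (B : Fin n → Matrix (Fin 2) (Fin 2) ℝ) (hB : ∀ k, (B k).IsSymm) :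
    (Matrix.reindex finProdFinEquiv finProdFinEquiv (Matrix.blockDiagonal B)).IsSymm := by
  have hB' : (fun k => (B k)ᵀ) = B := funext fun k => (hB k).eq
  unfold Matrix.IsSymm
  rw [Matrix.reindex_apply, Matrix.transpose_submatrix, Matrix.blockDiagonal_transpose, hB']

/-- **the pencil determinant of block letters is the product of the block pencil determinants**
(`det` commutes with reindexing; `Matrix.det_blockDiagonal`). [folklore] -/
theorem pencilDet_blockLetters {K n : ℕ} (d : Fin K → ℕ) (B : Fin n → Fin K → Matrix (Fin 2) (Fin 2) ℝ) :
    pencilDet d (fun l => Matrix.reindex finProdFinEquiv finProdFinEquiv (Matrix.blockDiagonal fun i => B i l)) =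
      ∏ i, pencilDet d (B i) := by
  unfold pencilDet
  have h : (∑ l, (X : ℝ[X]) ^ d l •
        (Matrix.reindex finProdFinEquiv finProdFinEquiv (Matrix.blockDiagonal fun i => B i l)).map C) =
      Matrix.reindex finProdFinEquiv finProdFinEquiv
        (Matrix.blockDiagonal fun i => ∑ l, (X : ℝ[X]) ^ d l • (B i l).map C) := by
    ext p q : 1
    simp only [Matrix.sum_apply, Matrix.smul_apply, Matrix.map_apply, Matrix.reindex_apply, Matrix.submatrix_apply,
      Matrix.blockDiagonal_apply]
    by_cases hpq : (finProdFinEquiv.symm p).2 = (finProdFinEquiv.symm q).2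
    · simp only [if_pos hpq]
    · simp only [if_neg hpq, map_zero, smul_zero, Finset.sum_const_zero]
  rw [h, Matrix.det_reindex_self, Matrix.det_blockDiagonal]

/-! ## One rung as a `(2, 2)` pencil: `d = (0, 1)`, `S₀ = [[-a, ε], [ε, a]]`, `S₁ = diag(1, -1)` -/

/-- `det [[X - a, ε], [ε, a - X]] = -((X - a)² + ε²)`. [folklore] -/
theorem pencilDet_rung (a ε : ℝ) :
    pencilDet (![0, 1] : Fin 2 → ℕ) (![!![-a, ε; ε, a], !![1, 0; 0, -1]] : Fin 2 → Matrix (Fin 2) (Fin 2) ℝ) =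
      -((X - C a) ^ 2 + C (ε ^ 2)) := by
  unfold pencilDet
  rw [Matrix.det_fin_two]
  simp [Matrix.sum_apply, Fin.sum_univ_two, map_pow]
  ring

/-- the rung letters are symmetric. [folklore] -/
theorem rung_isSymm (a ε : ℝ) :
    ∀ l, ((![!![-a, ε; ε, a], !![1, 0; 0, -1]] : Fin 2 → Matrix (Fin 2) (Fin 2) ℝ) l).IsSymm := by
  intro l
  fin_cases l <;> (refine Matrix.IsSymm.ext ?_; intro i j; fin_cases i <;> fin_cases j <;> simp)

/-! ## The block ladder at format `(2(k+1), 2)` -/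

/-- **The block ladder: `k + 1` fragile octaves at format `(m, K) = (2(k+1), 2)`.**  For every `k` and every `ε ≠ 0` there are
injective exponents `d = (0, 1)`, symmetric letters `S = (⊕ᵢ diag(-2^i, 2^i), ⊕ᵢ diag(1, -1))` with entry scales `ρ = (2^k, 1)`
(certified on `S`, both `≥ 1`), and the symmetric perturbation `S' = (⊕ᵢ [[-2^i, ε], [ε, 2^i]], S₁)` at entrywise distance `≤ |ε|`,
such that both pencil determinants are nonzero, `Ω(pencilDet d S) = k + 1` (double roots `2^0, …, 2^k`, one per octave) and
`Ω(pencilDet d S') = 0` (no real root survives). [folklore; explicit witness] -/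
theorem fragileOctaves_blockLadder (k : ℕ) {ε : ℝ} (hε : ε ≠ 0) :
    ∃ (d : Fin 2 → ℕ) (S S' : Fin 2 → Matrix (Fin (2 * (k + 1))) (Fin (2 * (k + 1))) ℝ) (ρ : Fin 2 → ℝ),
      Function.Injective d ∧ (∀ l, (S l).IsSymm) ∧ (∀ l, (S' l).IsSymm) ∧ (∀ l, 1 ≤ ρ l) ∧
      (∀ l, (∀ i j, |S l i j| ≤ ρ l) ∧ ∃ i j, ρ l ≤ |S l i j|) ∧ (∀ l i j, |S' l i j - S l i j| ≤ |ε|) ∧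
      pencilDet d S ≠ 0 ∧ pencilDet d S' ≠ 0 ∧
      octaveCount (pencilDet d S) = k + 1 ∧ octaveCount (pencilDet d S') = 0 := by
  refine ⟨![0, 1],
    fun l => Matrix.reindex finProdFinEquiv finProdFinEquiv (Matrix.blockDiagonal fun i : Fin (k + 1) =>
      (![!![-(2 : ℝ) ^ (i : ℕ), 0; 0, (2 : ℝ) ^ (i : ℕ)], !![1, 0; 0, -1]] : Fin 2 → Matrix (Fin 2) (Fin 2) ℝ) l),
    fun l => Matrix.reindex finProdFinEquiv finProdFinEquiv (Matrix.blockDiagonal fun i : Fin (k + 1) =>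
      (![!![-(2 : ℝ) ^ (i : ℕ), ε; ε, (2 : ℝ) ^ (i : ℕ)], !![1, 0; 0, -1]] : Fin 2 → Matrix (Fin 2) (Fin 2) ℝ) l),
    ![(2 : ℝ) ^ k, 1], ?_, ?_, ?_, ?_, ?_, ?_, ?_, ?_, ?_, ?_⟩
  · -- `d = (0, 1)` is injective
    intro i j h
    fin_cases i <;> fin_cases j <;> simp_all
  · -- `S` symmetric
    intro l
    exact blockLetter_isSymm _ fun i => rung_isSymm ((2 : ℝ) ^ (i : ℕ)) 0 l
  · -- `S'` symmetric
    intro l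
    exact blockLetter_isSymm _ fun i => rung_isSymm ((2 : ℝ) ^ (i : ℕ)) ε l
  · -- scales `≥ 1`
    intro l
    fin_cases l
    · exact one_le_pow₀ (by norm_num)
    · exact le_rfl
  · -- entry scales certified on `S`
    intro l
    fin_cases l
    · refine ⟨fun p q => abs_blockLetter_le _ (by show (0 : ℝ) ≤ 2 ^ k; positivity) (fun i a b => ?_) p q,
        finProdFinEquiv (0, Fin.last k), finProdFinEquiv (0, Fin.last k), ?_⟩
      · have hi : (2 : ℝ) ^ (i : ℕ) ≤ 2 ^ k := pow_le_pow_right₀ (by norm_num) (Nat.lt_succ_iff.mp i.isLt)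
        fin_cases a <;> fin_cases b <;> simp [abs_of_pos, hi]
      · simp
    · refine ⟨fun p q => abs_blockLetter_le _ zero_le_one (fun i a b => ?_) p q,
        finProdFinEquiv (0, 0), finProdFinEquiv (0, 0), ?_⟩
      · fin_cases a <;> fin_cases b <;> simp
      · simp
  · -- `S'` is entrywise within `|ε|` of `S`
    intro l p q
    rw [blockLetter_sub]
    refine abs_blockLetter_le _ (abs_nonneg ε) (fun i a b => ?_) p q
    fin_cases l <;> fin_cases a <;> fin_cases b <;> simp
  · -- `pencilDet d S ≠ 0`
    rw [pencilDet_blockLetters]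
    simp_rw [pencilDet_rung]
    exact ladder_ne_zero _ 0
  · -- `pencilDet d S' ≠ 0`
    rw [pencilDet_blockLetters]
    simp_rw [pencilDet_rung]
    exact ladder_ne_zero _ ε
  · -- `Ω(pencilDet d S) = k + 1`
    rw [pencilDet_blockLetters]
    simp_rw [pencilDet_rung]
    exact ladder_octaveCount_zero (k + 1)
  · -- `Ω(pencilDet d S') = 0`
    rw [pencilDet_blockLetters]
    simp_rw [pencilDet_rung]
    exact ladder_octaveCount_ne _ hε

/-! ## Consequences for the conditioning shape of K1 -/

/-- **No K1-shaped law whose additive budget drops below `m/2` on the row `(m, 2, m)`.**  For every precision exponent `P`, every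
multiplicative constant `A` and every budget function `b` with `b(2(k+1), 2, 2(k+1)) < k + 1` for some `k`, the statement
«`TropRootLawAt m K n` ⇒ (K1's hypotheses at precision `2^{P(m,K,n)}`) ⇒ `Ω(pencilDet d S) ≤ b(m,K,n) + A·Ω(pencilDet d S')`» is
false: the block ladder at `(2(k+1), 2, 2(k+1))` (`tropRootLawAt_poly`, `ε = 2^{-P}`) gives `k + 1 ≤ b + A·0`. [folklore; explicit witness] -/
theorem octaveStability_false_of_budget_lt (P b : ℕ → ℕ → ℕ → ℕ) (A k : ℕ)
    (hb : b (2 * (k + 1)) 2 (2 * (k + 1)) < k + 1) :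
    ¬ (∀ (m K n : ℕ), TropRootLawAt m K n →
        ∀ (d : Fin K → ℕ) (S S' : Fin K → Matrix (Fin m) (Fin m) ℝ) (ρ : Fin K → ℝ), Function.Injective d →
          (∀ l, (S l).IsSymm) → (∀ l, (S' l).IsSymm) → (∀ l, 0 < ρ l) →
          (∀ l, (∀ i j, |S l i j| ≤ ρ l) ∧ ∃ i j, ρ l ≤ |S l i j|) →
          (∀ l i j, (2 : ℝ) ^ (P m K n) * |S' l i j - S l i j| ≤ ρ l) →
          pencilDet d S' ≠ 0 →
          octaveCount (pencilDet d S) ≤ b m K n + A * octaveCount (pencilDet d S')) := by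
  intro h
  have hrow : TropRootLawAt (2 * (k + 1)) 2 (2 * (k + 1)) := by
    simpa using tropRootLawAt_poly (2 * (k + 1)) 2
  set p : ℕ := P (2 * (k + 1)) 2 (2 * (k + 1)) with hp
  have h2 : (0 : ℝ) < (2 : ℝ) ^ p := by positivity
  have hε : ((2 : ℝ) ^ p)⁻¹ ≠ 0 := (inv_pos.2 h2).ne'
  obtain ⟨d, S, S', ρ, hd, hS, hS', hρ, hsc, hdist, -, hne', hΩ, hΩ'⟩ := fragileOctaves_blockLadder k hε
  have key := h _ 2 _ hrow d S S' ρ hd hS hS' (fun l => one_pos.trans_le (hρ l)) hsc ?_ hne'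
  · rw [hΩ, hΩ'] at key
    omega
  · intro l i j
    have := hdist l i j
    rw [abs_inv, abs_of_pos h2] at this
    calc (2 : ℝ) ^ p * |S' l i j - S l i j| ≤ (2 : ℝ) ^ p * ((2 : ℝ) ^ p)⁻¹ := by gcongr
      _ = 1 := mul_inv_cancel₀ h2.ne'
      _ ≤ ρ l := hρ l

/-- **The price, stated positively**: every valid law of K1's shape (any precision `P`, any multiplicative constant `A`) has additive
budget `b(m, 2, m) ≥ m/2` at every even `m` — at least half the tropical count `n = m` of the certified polynomial row, where the
absolute Descartes bound is already `Ω ≤ m`. [folklore; explicit witness] -/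
theorem budget_ge_half_of_octaveStabilityShape (P b : ℕ → ℕ → ℕ → ℕ) (A : ℕ)
    (h : ∀ (m K n : ℕ), TropRootLawAt m K n →
        ∀ (d : Fin K → ℕ) (S S' : Fin K → Matrix (Fin m) (Fin m) ℝ) (ρ : Fin K → ℝ), Function.Injective d →
          (∀ l, (S l).IsSymm) → (∀ l, (S' l).IsSymm) → (∀ l, 0 < ρ l) →
          (∀ l, (∀ i j, |S l i j| ≤ ρ l) ∧ ∃ i j, ρ l ≤ |S l i j|) →
          (∀ l i j, (2 : ℝ) ^ (P m K n) * |S' l i j - S l i j| ≤ ρ l) →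
          pencilDet d S' ≠ 0 →
          octaveCount (pencilDet d S) ≤ b m K n + A * octaveCount (pencilDet d S'))
    (k : ℕ) : k + 1 ≤ b (2 * (k + 1)) 2 (2 * (k + 1)) :=
  not_lt.1 fun hb => octaveStability_false_of_budget_lt P b A k hb h

/-- **No bounded additive budget**: K1's shape with the additive term replaced by a constant `B` is false for every `B`, every
multiplicative constant `A` and every precision `P` (block ladder with `B + 1` rungs). [folklore; explicit witness] -/
theorem octaveStability_false_with_bounded_budget (P : ℕ → ℕ → ℕ → ℕ) (A B : ℕ) :
    ¬ (∀ (m K n : ℕ), TropRootLawAt m K n →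
        ∀ (d : Fin K → ℕ) (S S' : Fin K → Matrix (Fin m) (Fin m) ℝ) (ρ : Fin K → ℝ), Function.Injective d →
          (∀ l, (S l).IsSymm) → (∀ l, (S' l).IsSymm) → (∀ l, 0 < ρ l) →
          (∀ l, (∀ i j, |S l i j| ≤ ρ l) ∧ ∃ i j, ρ l ≤ |S l i j|) →
          (∀ l i j, (2 : ℝ) ^ (P m K n) * |S' l i j - S l i j| ≤ ρ l) →
          pencilDet d S' ≠ 0 →
          octaveCount (pencilDet d S) ≤ B + A * octaveCount (pencilDet d S')) :=
  octaveStability_false_of_budget_lt P (fun _ _ _ => B) A B (Nat.lt_succ_self B)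

/-- **No letter-count budget**: K1's shape with an additive budget `f(K)` depending on the number of letters alone (neither on `m`
nor on the row `n`) is false for every `f`, `A`, `P` (block ladder with `f(2) + 1` rungs: `K = 2` throughout). [folklore; explicit witness] -/
theorem octaveStability_false_with_letter_budget (P : ℕ → ℕ → ℕ → ℕ) (A : ℕ) (f : ℕ → ℕ) :
    ¬ (∀ (m K n : ℕ), TropRootLawAt m K n →
        ∀ (d : Fin K → ℕ) (S S' : Fin K → Matrix (Fin m) (Fin m) ℝ) (ρ : Fin K → ℝ), Function.Injective d →
          (∀ l, (S l).IsSymm) → (∀ l, (S' l).IsSymm) → (∀ l, 0 < ρ l) →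
          (∀ l, (∀ i j, |S l i j| ≤ ρ l) ∧ ∃ i j, ρ l ≤ |S l i j|) →
          (∀ l i j, (2 : ℝ) ^ (P m K n) * |S' l i j - S l i j| ≤ ρ l) →
          pencilDet d S' ≠ 0 →
          octaveCount (pencilDet d S) ≤ f K + A * octaveCount (pencilDet d S')) :=
  octaveStability_false_of_budget_lt P (fun _ K _ => f K) A (f 2) (Nat.lt_succ_self _)

/-- **K1 itself is not hit**: its budget `2^{C(K+⌊log₂m⌋²)}(n+1)` on the block-ladder row `(2(k+1), 2, 2(k+1))` is at least `k + 1`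
for every `C` (the additive term alone already pays for all `m/2` fragile octaves). [folklore] -/
theorem octaveStability_budget_at_blockLadder (C k : ℕ) :
    k + 1 ≤ 2 ^ (C * (2 + Nat.log 2 (2 * (k + 1)) ^ 2)) * (2 * (k + 1) + 1) := by
  have h1 : 1 ≤ 2 ^ (C * (2 + Nat.log 2 (2 * (k + 1)) ^ 2)) := Nat.one_le_two_pow
  nlinarith

end Summit.ValiantsHypothesis.ValiantsHypothesis.Theorems.WeakLifting.Negative
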